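import Literature.AlgebraicGeometry.Milne1999.LefschetzCentraliserRosatiInvolution
import Literature.AlgebraicGeometry.Motives.FaltingsAbelianOfFinitenessIProofs
import Literature.AlgebraicGeometry.Crystalline.GlobalFunctionsDifferential
import Mathlib.LinearAlgebra.Eigenspace.Pi
import Mathlib.LinearAlgebra.Eigenspace.Semisimple
import Mathlib.LinearAlgebra.Lagrange
import Mathlib.RingTheory.Jacobson.Semiprimary
import Mathlib.FieldTheory.Perfect
import HarnessLib

/-!
# Milne 1999, Theorem 3.2 / Corollary 4.5 for every complex abelian variety with commutative endomorphism ring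

Family `hodge`, layer `Literature/AlgebraicGeometry/Milne1999`, namespace
`Literature.AlgebraicGeometry.Milne1999` (D-0022). THEOREMS ONLY (no definition, no named fact; D-0026).
Written for the cell `pub-hodgecm2` (COR-CM), seat `lit-milne`, binder table `HOME/lit/milne.md` rows
M2/M4, as the sequel of `Milne1999/LefschetzCentraliserRosatiInvolution`, whose §3 proves the conclusion
of the cited record `Milne1999_specialLefschetzGroup_invariants_le` (`Milne1999/LefschetzGroup`: for EVERY
complex abelian variety the classes of `H²ᵖ(A(ℂ); ℂ)` fixed by `specialLefschetzGroup (dim A) A.X` lie in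
`Dᵖ_hom(A)_ℂ`; Milne 1999 Cor. 4.5 with Thm. 4.4 and Thm. 3.2) under the hypotheses «every `ψ^*`,
`ψ ∈ End(A)`, is a polynomial in ONE `φ^*`» and «`φ^*` is diagonalisable on `H¹(A(ℂ); ℂ)`».  This file
DISCHARGES both from the single intrinsic hypothesis

  **`End(A)` is commutative** — `∀ φ ψ : A ⟶ A, φ ≫ ψ = ψ ≫ φ`

(equivalently `End⁰(A) = ℚ ⊗ End(A)` is commutative, `forall_comp_comm_iff_endAlgebra_comm`; e.g.
`End⁰(A)` a field).  By [Milne1999LefschetzClasses] §2 (pp. 645–650, following Mumford p. 201) these are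
the complex abelian varieties isogenous to a product of pairwise non-isogenous SIMPLE abelian varieties
each of type I (`End⁰ = F` a totally real field) or of type IV with `d = 1` (`End⁰ = K` a CM field) —
for which Milne computes `S(A)(ℂ) = ∏ Sp` resp. `∏ GL` («standard representation and its
contragredient», p. 650) and Thm. 3.2 follows from Prop. 3.6 (a), (c) with `r = 1`.  Main results:

* **`specialLefschetzGroup_invariants_le_of_forall_comp_comm`** — the conclusion of the record for every
  complex abelian variety with commutative `End(A)`; `setOf_forall_apply_eq_self_eq_divisorClassesSpan_of_forall_comp_comm`
  (Cor. 4.5 as an equality of sets); `isDivisorGenerated_of_hodgeGroup_eq_specialLefschetzGroup_of_forall_comp_comm`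
  (Prop. 4.8 (c) ⇒ (a) on `A`); `mem_divisorClassesSpan_of_forall_exteriorPullback_eq_of_forall_comp_comm`
  (the `S(A)(ℂ) = unitaryCentralizerGroup A h`-invariant form for a given polarization class `h`); the
  variants `…_of_endAlgebra_comm` and `…_of_isField_endAlgebra`.

The two discharges:

* §2 **`isSemisimple_pullbackOne_of_forall_comp_comm`** — for commutative `End(A)`, every `ψ^*` is
  semisimple (diagonalisable) on `H¹(A(ℂ); ℂ)`: `End⁰(A)` is a semisimple ring (Mumford §19 Cor. 2 of
  Thm. 1, the tree's `AbelianVariety.isSemisimpleRing_endAlgebra_of_perfectField`, from Poincaré's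
  complete reducibility) and commutative (`endAlgebra_comm_of_forall_comp_comm`), hence reduced
  (`isReduced_endAlgebra_of_forall_comp_comm`), so the minimal polynomial of `1 ⊗ ψ` over `ℚ` is
  squarefree (`Crystalline.squarefree_minpoly_of_isReduced`), i.e. separable; clearing denominators it
  kills `ψ` in `End(A)` (`endAlgebra.of` is injective) hence `ψ^*` on `H¹`
  (`aeval_hom_complexBetti_map_one_eq_zero`), and an operator killed by a squarefree polynomial is
  semisimple (Mathlib `Module.End.isSemisimple_of_squarefree_aeval_eq_zero`).
* §1 **`exists_forall_mem_adjoin_of_commute`** (linear algebra; Milne §2 p. 646 «`1 = e₁ + ⋯ + e_t`,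
  `V_i = e_i V`» for the algebra generated by the family) — for an additive family
  `F : M →+ End_ℂ(V)` of pairwise commuting semisimple operators on a finite-dimensional `V` there is
  `m₀ ∈ M` such that EVERY `F m` is a polynomial in `F m₀`: the joint eigenspaces
  `W_χ = ⋂_m ker(F m - χ(m))` span `V` (Mathlib's simultaneous decomposition for commuting families,
  semisimplicity turning generalised eigenspaces into eigenspaces), only finitely many are non-zero and
  their `χ` are additive, so an `m₀` with `χ(m₀) ≠ χ'(m₀)` for all occurring `χ ≠ χ'` exists
  (`exists_forall_ne_zero_of_forall_add`: avoid finitely many values along an affine line `m + t m'`,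
  `t ∈ ℕ`); then `F m = p(F m₀)` for the Lagrange polynomial `p` with `p(χ(m₀)) = χ(m)`.
  Applied to `ψ ↦ ψ^*` (`exists_forall_pullbackOne_mem_adjoin_of_forall_comp_comm`).

NOT Milne's road for Thm. 3.2 (the first fundamental theorem of invariant theory, Prop. 3.6); types
II/III, type IV with `d ≥ 2` and isotypic powers (non-commutative `End⁰(A)`) are NOT covered — the
record stays cited there.

## References

* [Milne1999LefschetzClasses] J. S. Milne, Lefschetz classes on abelian varieties, Duke Math. J. 96
  (1999) 639–675: §1 pp. 642–644, §2 pp. 645–650 (the four types; p. 646 the idempotents `e_i`),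
  Thm. 3.2, Prop. 3.6 (a), (c), p. 656, Thm. 4.4, Cor. 4.5 (p. 659), Prop. 4.8 (p. 660).
* [MumfordAV1970] D. Mumford, Abelian Varieties (1970), §19 Thm. 1, Cor. 2 (p. 174: `End⁰(X)` is
  semisimple), p. 201 (the four types).
* [LangeBirkenhake1992] H. Lange, Ch. Birkenhake, Complex Abelian Varieties (1992), §1.2 (the rational
  representation), §5.1, Thm. 5.5.3/5.5.6.
* [Deligne1982HodgeCycles] P. Deligne (notes by J. S. Milne), Hodge cycles on abelian varieties, LNM 900
  (1982), I §3 Prop. 3.4, §4 p. 30 (the eigenspace decomposition `H¹ ⊗ ℂ = ⊕_σ H¹_σ`).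
-/

noncomputable section

open CategoryTheory Polynomial
open Literature.AlgebraicTopology.SingularHomology
open Literature.AlgebraicGeometry.HodgeTheory
open Literature.AlgebraicGeometry.Motives
open Literature.AlgebraicGeometry.VanGeemen1994 (pullbackOne hodgeClassSpan)
open Literature.Barriers.HodgeConjecture (divisorClassesSpan)

namespace Literature.AlgebraicGeometry.Milne1999

/-! ### §1 Linear algebra: a commuting family of semisimple operators is generated by one of them -/

section Separating

variable {M : Type*} [AddCommGroup M]

/-- **Avoiding finitely many zeros along an affine line.** For finitely many ADDITIVE functions
`d_j : M → ℂ`, each non-zero somewhere, there is ONE `m ∈ M` with `d_j(m) ≠ 0` for all `j` (induction: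
given `m` good for all but `j₀` and `m'` with `d_{j₀}(m') ≠ 0`, the values `d_j(m + t m') = d_j(m) + t d_j(m')`,
`t ∈ ℕ`, vanish for at most one `t` each). [folklore] -/
private theorem exists_forall_ne_zero_of_forall_add {J : Type*} (s : Finset J) (d : J → M → ℂ)
    (hadd : ∀ j ∈ s, ∀ m m' : M, d j (m + m') = d j m + d j m')
    (hd : ∀ j ∈ s, ∃ m : M, d j m ≠ 0) : ∃ m : M, ∀ j ∈ s, d j m ≠ 0 := by
  classical
  induction s using Finset.induction_on with
  | empty => exact ⟨0, fun j hj => absurd hj (Finset.notMem_empty j)⟩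
  | insert j₀ s hj₀ ih =>
    obtain ⟨m, hm⟩ := ih (fun j hj => hadd j (Finset.mem_insert_of_mem hj))
      fun j hj => hd j (Finset.mem_insert_of_mem hj)
    obtain ⟨m', hm'⟩ := hd j₀ (Finset.mem_insert_self j₀ s)
    -- along the line `m + t • m'`
    have hlin : ∀ j ∈ insert j₀ s, ∀ t : ℕ, d j (m + t • m') = d j m + (t : ℂ) * d j m' := by
      intro j hj t
      induction t with
      | zero => rw [zero_nsmul, add_zero, Nat.cast_zero, zero_mul, add_zero]
      | succ t iht =>
        rw [succ_nsmul, ← add_assoc, hadd j hj, iht, Nat.cast_succ]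
        ring
    -- the bad parameters: at most one per `j`
    let bad : J → Set ℕ := fun j => {t | d j m + (t : ℂ) * d j m' = 0}
    have hbad : ∀ j ∈ insert j₀ s, (bad j).Subsingleton := by
      intro j hj t ht t' ht'
      simp only [bad, Set.mem_setOf_eq] at ht ht'
      by_cases h0 : d j m' = 0
      · exfalso
        rw [h0, mul_zero, add_zero] at ht
        rcases Finset.mem_insert.1 hj with rfl | hj'
        · exact hm' h0
        · exact hm j hj' ht
      · have e : (t : ℂ) * d j m' = (t' : ℂ) * d j m' := by linear_combination ht - ht'
        exact_mod_cast mul_right_cancel₀ h0 e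
    have hfin : (⋃ j ∈ insert j₀ s, bad j).Finite :=
      Set.Finite.biUnion (Finset.finite_toSet _) fun j hj => (hbad j hj).finite
    obtain ⟨t, -, ht⟩ := Set.infinite_univ.exists_notMem_finite hfin
    refine ⟨m + t • m', fun j hj h0 => ht ?_⟩
    rw [hlin j hj t] at h0
    exact Set.mem_biUnion hj h0

variable {V : Type*} [AddCommGroup V] [Module ℂ V]

/-- On an eigenvector (or `0`) a polynomial in `f` acts by the value of the polynomial. [folklore] -/
private theorem aeval_apply_of_mem_eigenspace {f : Module.End ℂ V} {μ : ℂ} {x : V}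
    (hx : x ∈ f.eigenspace μ) (p : ℂ[X]) : aeval f p x = p.eval μ • x := by
  by_cases hx0 : x = 0
  · rw [hx0, map_zero, smul_zero]
  · exact Module.End.aeval_apply_of_hasEigenvector ⟨hx, hx0⟩

variable [FiniteDimensional ℂ V]

/-- **A commuting additive family of semisimple operators is generated by one member** (the shape of
Milne's `C(A) ⊗ ℂ = ∏ End(V_i)`, `V_i = e_i V`, `1 = e₁ + ⋯ + e_t` the primitive idempotents of the
commutative algebra generated by the family, §2 p. 646): for `F : M →+ End_ℂ(V)` additive with
pairwise commuting SEMISIMPLE values on a finite-dimensional `V`, there is `m₀ ∈ M` such that every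
`F m` is a polynomial in `F m₀`.  Proof: the joint eigenspaces `W_χ = ⋂_m ker(F m - χ(m))`, `χ : M → ℂ`,
are independent and span `V` (Mathlib's simultaneous decomposition of commuting families; semisimplicity
makes generalised eigenspaces honest ones); finitely many are non-zero, and for those `χ` is additive;
`exists_forall_ne_zero_of_forall_add` gives `m₀` separating them; on `W_χ ⊆ ker(F m₀ - χ(m₀))` both
`F m` and `p(F m₀)` act by `χ(m) = p(χ(m₀))` for the Lagrange interpolation polynomial `p`.
[cite: Milne1999LefschetzClasses, §2 p. 646] [cite: Deligne1982HodgeCycles, §4 p. 30] -/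
theorem exists_forall_mem_adjoin_of_commute (F : M →+ Module.End ℂ V)
    (hc : ∀ m m' : M, Commute (F m) (F m')) (hss : ∀ m : M, (F m).IsSemisimple) :
    ∃ m₀ : M, ∀ m : M, F m ∈ Algebra.adjoin ℂ {F m₀} := by
  classical
  -- joint eigenspaces
  let W : (M → ℂ) → Submodule ℂ V := fun χ => ⨅ m, (F m).eigenspace (χ m)
  have hmax : ∀ (m : M) (μ : ℂ), (F m).maxGenEigenspace μ = (F m).eigenspace μ := fun m μ =>
    (Module.End.isFinitelySemisimple_iff_isSemisimple.mpr (hss m)).maxGenEigenspace_eq_eigenspace μ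
  have hind : iSupIndep W := by
    have key : iSupIndep fun χ : M → ℂ => ⨅ m, (F m).maxGenEigenspace (χ m) :=
      Module.End.independent_iInf_maxGenEigenspace_of_forall_mapsTo (fun m => F m) fun m m' φ =>
        Module.End.mapsTo_maxGenEigenspace_of_comm (hc m' m) φ
    simpa only [hmax] using key
  have htop : ⨆ χ, W χ = ⊤ := by
    have key := Module.End.iSup_iInf_maxGenEigenspace_eq_top_of_iSup_maxGenEigenspace_eq_top_of_commute
      (fun m => F m) (fun m m' _ => hc m m') fun m => Module.End.iSup_maxGenEigenspace_eq_top (F m)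
    simpa only [hmax] using key
  -- the scalar action on `W χ`
  have hact : ∀ (χ : M → ℂ) (m : M), ∀ v ∈ W χ, F m v = χ m • v := fun χ m v hv =>
    Module.End.mem_eigenspace_iff.1 ((Submodule.mem_iInf _).1 hv m)
  -- finitely many non-zero joint eigenspaces; their `χ` are additive
  have hSfin : {χ : M → ℂ | W χ ≠ ⊥}.Finite := WellFoundedGT.finite_ne_bot_of_iSupIndep hind
  set T : Finset (M → ℂ) := hSfin.toFinset with hT
  have hmemT : ∀ χ, χ ∈ T ↔ W χ ≠ ⊥ := fun χ => by rw [hT, Set.Finite.mem_toFinset]; rfl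
  have haddT : ∀ χ ∈ T, ∀ m m' : M, χ (m + m') = χ m + χ m' := by
    intro χ hχ m m'
    obtain ⟨v, hv, hv0⟩ := Submodule.exists_mem_ne_zero_of_ne_bot ((hmemT χ).1 hχ)
    have e : χ (m + m') • v = (χ m + χ m') • v := by
      rw [← hact χ (m + m') v hv, map_add, LinearMap.add_apply, hact χ m v hv, hact χ m' v hv, add_smul]
    exact smul_left_injective ℂ hv0 e
  -- a separating element
  let d : (M → ℂ) × (M → ℂ) → M → ℂ := fun q m => q.1 m - q.2 m
  set P : Finset ((M → ℂ) × (M → ℂ)) := (T ×ˢ T).filter (fun q => q.1 ≠ q.2) with hP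
  have hPmem : ∀ q ∈ P, q.1 ∈ T ∧ q.2 ∈ T ∧ q.1 ≠ q.2 := fun q hq => by
    rw [hP, Finset.mem_filter, Finset.mem_product] at hq
    exact ⟨hq.1.1, hq.1.2, hq.2⟩
  obtain ⟨m₀, hm₀⟩ : ∃ m₀ : M, ∀ q ∈ P, d q m₀ ≠ 0 := by
    refine exists_forall_ne_zero_of_forall_add P d (fun q hq m m' => ?_) fun q hq => ?_
    · obtain ⟨h1, h2, -⟩ := hPmem q hq
      simp only [d]
      rw [haddT _ h1, haddT _ h2]
      ring
    · obtain ⟨-, -, hne⟩ := hPmem q hq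
      obtain ⟨m, hm⟩ := Function.ne_iff.1 hne
      exact ⟨m, sub_ne_zero.2 hm⟩
  have hsep : Set.InjOn (fun χ : M → ℂ => χ m₀) (T : Set (M → ℂ)) := by
    intro χ hχ χ' hχ' h
    by_contra hne
    have hq : (χ, χ') ∈ P := by
      rw [hP, Finset.mem_filter, Finset.mem_product]
      exact ⟨⟨hχ, hχ'⟩, hne⟩
    exact hm₀ _ hq (sub_eq_zero.2 h)
  refine ⟨m₀, fun m => ?_⟩
  -- `F m` is the Lagrange polynomial of `χ(m₀) ↦ χ(m)` evaluated at `F m₀`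
  set p : ℂ[X] := Lagrange.interpolate T (fun χ : M → ℂ => χ m₀) (fun χ : M → ℂ => χ m) with hp
  have hagree : ∀ χ, ∀ v ∈ W χ, F m v = aeval (F m₀) p v := by
    intro χ v hv
    by_cases hv0 : v = 0
    · rw [hv0, map_zero, map_zero]
    have hχ : χ ∈ T := (hmemT χ).2 fun h => hv0 ((Submodule.mem_bot ℂ).1 (h ▸ hv))
    have hv₀ : v ∈ (F m₀).eigenspace (χ m₀) := (Submodule.mem_iInf _).1 hv m₀
    rw [aeval_apply_of_mem_eigenspace hv₀, hact χ m v hv, hp,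
      Lagrange.eval_interpolate_at_node _ hsep hχ]
  have heq : F m = aeval (F m₀) p := by
    refine LinearMap.ext fun v => ?_
    have hv : v ∈ ⨆ χ, W χ := by rw [htop]; exact Submodule.mem_top
    induction hv using Submodule.iSup_induction' with
    | mem χ v hv => exact hagree χ v hv
    | zero => rw [map_zero, map_zero]
    | add x y _ _ hx hy => rw [map_add, map_add, hx, hy]
  rw [heq]
  exact Polynomial.aeval_mem_adjoin_singleton ℂ (F m₀)

end Separating

/-! ### §2 Commutative `End(A)`: every `ψ^*` is semisimple on `H¹(A(ℂ); ℂ)` -/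

section Semisimple

variable {A : AbelianVariety ℂ}

/-- `(φ ≫ ψ)^* = φ^* ∘ ψ^*` on `H¹`, in `Module.End`. [folklore] -/
private theorem pullbackOne_comp (φ ψ : A ⟶ A) : pullbackOne A (φ ≫ ψ) = pullbackOne A φ * pullbackOne A ψ := by
  change (complexBetti.map (φ.hom.hom.hom ≫ ψ.hom.hom.hom) 1).hom = _
  rw [complexBetti.map_comp, ModuleCat.hom_comp]
  rfl

/-- **`End(A)` commutative ⟺ `End⁰(A) = ℚ ⊗ End(A)` commutative** (`End(A) ↪ End⁰(A)` for the
torsion-free `End(A)`, `endAlgebra.of_injective_of_charZero`; every element of `End⁰(A)` is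
`M⁻¹ · (1 ⊗ F)`, `endAlgebra.exists_eq_algebraMap_mul_of`). [cite: MumfordAV1970, §19 (Thm. 3 and Cor. 2 of Thm. 1)] -/
theorem forall_comp_comm_iff_endAlgebra_comm :
    (∀ φ ψ : A ⟶ A, φ ≫ ψ = ψ ≫ φ) ↔ ∀ x y : A.endAlgebra, x * y = y * x := by
  constructor
  · intro hcomm x y
    obtain ⟨M, F, -, rfl⟩ := AbelianVariety.endAlgebra.exists_eq_algebraMap_mul_of x
    obtain ⟨N, G, -, rfl⟩ := AbelianVariety.endAlgebra.exists_eq_algebraMap_mul_of y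
    have hFG : AbelianVariety.endAlgebra.of A F * AbelianVariety.endAlgebra.of A G =
        AbelianVariety.endAlgebra.of A G * AbelianVariety.endAlgebra.of A F := by
      rw [← map_mul, ← map_mul, CategoryTheory.End.mul_def, CategoryTheory.End.mul_def, hcomm G F]
    rw [← Algebra.smul_def, ← Algebra.smul_def, smul_mul_assoc, mul_smul_comm, smul_mul_assoc,
      mul_smul_comm, hFG, smul_comm]
  · intro hE φ ψ
    have h := hE (AbelianVariety.endAlgebra.of A ψ) (AbelianVariety.endAlgebra.of A φ)
    rw [← map_mul, ← map_mul, CategoryTheory.End.mul_def, CategoryTheory.End.mul_def] at h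
    exact AbelianVariety.endAlgebra.of_injective_of_charZero (A := A) h

/-- `End⁰(A)` is commutative when `End(A)` is. [cite: MumfordAV1970, §19] -/
theorem endAlgebra_comm_of_forall_comp_comm (hcomm : ∀ φ ψ : A ⟶ A, φ ≫ ψ = ψ ≫ φ)
    (x y : A.endAlgebra) : x * y = y * x :=
  forall_comp_comm_iff_endAlgebra_comm.1 hcomm x y

/-- **A commutative `End⁰(A)` is reduced**: `End⁰(A)` is a semisimple ring (Mumford §19 Cor. 2 of Thm. 1,
over the perfect field `ℂ`: the tree's `AbelianVariety.isSemisimpleRing_endAlgebra_of_perfectField`,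
Poincaré's complete reducibility), and a commutative semisimple ring is reduced (a product of fields;
Mathlib). [cite: MumfordAV1970, §19 Cor. 2 of Thm. 1 (p. 174)] [cite: Milne1999LefschetzClasses, §2 p. 646] -/
theorem isReduced_endAlgebra_of_forall_comp_comm (hcomm : ∀ φ ψ : A ⟶ A, φ ≫ ψ = ψ ≫ φ) :
    IsReduced A.endAlgebra := by
  haveI hss : IsSemisimpleRing A.endAlgebra := AbelianVariety.isSemisimpleRing_endAlgebra_of_perfectField A
  letI : CommRing A.endAlgebra :=
    { (inferInstance : Ring A.endAlgebra) with mul_comm := endAlgebra_comm_of_forall_comp_comm hcomm }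
  haveI : IsReduced A.endAlgebra := inferInstance
  exact this

/-- **The minimal polynomial over `ℚ` of `1 ⊗ ψ ∈ End⁰(A)` is squarefree** when `End(A)` is commutative
(`End⁰(A)` is then a reduced finite-dimensional commutative `ℚ`-algebra — a product of number fields,
Milne §2: `E ⊗ k = ∏ fields`). [cite: Milne1999LefschetzClasses, §2 pp. 645–646] [cite: MumfordAV1970, §19 Cor. 2 of Thm. 1] -/
theorem squarefree_minpoly_endAlgebra_of (hcomm : ∀ φ ψ : A ⟶ A, φ ≫ ψ = ψ ≫ φ) (ψ : A ⟶ A) :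
    Squarefree (minpoly ℚ (AbelianVariety.endAlgebra.of A ψ)) := by
  haveI : IsReduced A.endAlgebra := isReduced_endAlgebra_of_forall_comp_comm hcomm
  haveI : Module.Finite ℚ A.endAlgebra := AbelianVariety.finiteDimensional_endAlgebra_holds A
  letI : CommRing A.endAlgebra :=
    { (inferInstance : Ring A.endAlgebra) with mul_comm := endAlgebra_comm_of_forall_comp_comm hcomm }
  exact Crystalline.squarefree_minpoly_of_isReduced (IsIntegral.of_finite ℚ _)

/-- **For commutative `End(A)`, every `ψ^*` is semisimple on `H¹(A(ℂ); ℂ)`**: the squarefree, hence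
separable, minimal polynomial `m` of `1 ⊗ ψ` over `ℚ`, cleared of denominators, kills `ψ` in `End(A)`
(`endAlgebra.of` is injective), hence `m(ψ^*) = 0` on `H¹` (`aeval_hom_complexBetti_map_one_eq_zero`), and
`m ⊗ ℂ` is squarefree (Mathlib `Module.End.isSemisimple_of_squarefree_aeval_eq_zero`). So `φ^*` is
DIAGONALISABLE for every `φ ∈ End(A)` (`iSup_eigenspace_pullbackOne_eq_top_of_forall_comp_comm`): Milne §2,
`V(A) ⊗ k^{al} = ⊕_σ V_σ` for the commutative `E = End⁰(A)`. [cite: Milne1999LefschetzClasses, §2 pp. 646–650]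
[cite: LangeBirkenhake1992, §1.2 (the rational representation)] [cite: Deligne1982HodgeCycles, §4 p. 30] -/
theorem isSemisimple_pullbackOne_of_forall_comp_comm (hcomm : ∀ φ ψ : A ⟶ A, φ ≫ ψ = ψ ≫ φ)
    (ψ : A ⟶ A) : (pullbackOne A ψ).IsSemisimple := by
  set m : ℚ[X] := minpoly ℚ (AbelianVariety.endAlgebra.of A ψ) with hm_def
  have hsep : m.Separable := PerfectField.separable_iff_squarefree.mpr (squarefree_minpoly_endAlgebra_of hcomm ψ)
  -- clear denominators: `P ∈ ℤ[X]` with `P = b · m`, `b ≠ 0`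
  set P : ℤ[X] := IsLocalization.integerNormalization (nonZeroDivisors ℤ) m with hP
  obtain ⟨b, hbM, hb⟩ := IsLocalization.integerNormalization_spec (nonZeroDivisors ℤ) m
  rw [← hP, ← algebraMap_smul ℚ b m, Polynomial.smul_eq_C_mul] at hb
  have hb0 : (b : ℚ) ≠ 0 := by exact_mod_cast nonZeroDivisors.ne_zero hbM
  -- `P(1 ⊗ ψ) = 0` in `End⁰(A)`, hence `P(ψ) = 0` in `End(A)`
  have hPa : Polynomial.eval₂ ((algebraMap ℚ A.endAlgebra).comp (algebraMap ℤ ℚ))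
      (AbelianVariety.endAlgebra.of A ψ) P = 0 := by
    rw [← Polynomial.eval₂_map, hb, ← Polynomial.aeval_def, map_mul, hm_def, minpoly.aeval, mul_zero]
  have hPψ : Polynomial.eval₂ (Int.castRingHom (CategoryTheory.End A)) (End.of ψ) P = 0 := by
    apply AbelianVariety.endAlgebra.of_injective_of_charZero (A := A)
    rw [map_zero, Polynomial.hom_eval₂,
      RingHom.ext_int ((AbelianVariety.endAlgebra.of A).comp (Int.castRingHom (CategoryTheory.End A)))
        ((algebraMap ℚ A.endAlgebra).comp (algebraMap ℤ ℚ))]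
    exact hPa
  -- hence `P(ψ^*) = 0` on `H¹(A(ℂ); ℂ)` and `m(ψ^*) = 0`
  have hY : aeval (pullbackOne A ψ) (P.map (Int.castRingHom ℂ)) = 0 :=
    aeval_hom_complexBetti_map_one_eq_zero hPψ
  have hPC : P.map (Int.castRingHom ℂ) = C ((b : ℚ) : ℂ) * m.map (algebraMap ℚ ℂ) := by
    rw [map_castRingHom_complex_eq, ← algebraMap_int_eq, hb, Polynomial.map_mul, Polynomial.map_C]
    rfl
  have hm0 : aeval (pullbackOne A ψ) (m.map (algebraMap ℚ ℂ)) = 0 := by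
    rw [hPC, map_mul, Polynomial.aeval_C, Algebra.algebraMap_eq_smul_one, smul_mul_assoc, one_mul] at hY
    exact (smul_eq_zero.1 hY).resolve_left (by exact_mod_cast hb0)
  exact Module.End.isSemisimple_of_squarefree_aeval_eq_zero (hsep.map).squarefree hm0

/-- **For commutative `End(A)`, every `φ^*` is diagonalisable on `H¹(A(ℂ); ℂ)`** (`⨆_μ ker(φ^* - μ) = H¹`;
`ℂ` algebraically closed). [cite: Milne1999LefschetzClasses, §2 pp. 646–650] [cite: Deligne1982HodgeCycles, §4 p. 30] -/
theorem iSup_eigenspace_pullbackOne_eq_top_of_forall_comp_comm (hcomm : ∀ φ ψ : A ⟶ A, φ ≫ ψ = ψ ≫ φ)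
    (φ : A ⟶ A) : ⨆ μ : ℂ, Module.End.eigenspace (pullbackOne A φ) μ = ⊤ := by
  haveI : FiniteDimensional ℂ (complexBetti A.X 1) := finite_complexBetti_abelianVariety A 1
  exact (isSemisimple_pullbackOne_of_forall_comp_comm hcomm φ).iSup_eigenspace_eq_top

/-- **For commutative `End(A)` there is ONE endomorphism `φ` such that every `ψ^*`, `ψ ∈ End(A)`, is a
polynomial in `φ^*`** (`exists_forall_mem_adjoin_of_commute` for the additive family `ψ ↦ ψ^*` of
commuting semisimple operators): `C(A) ⊗ ℂ` is then the commutant of `φ^*` alone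
(`centralizerAlgebra_eq_centralizer_singleton_of_forall_mem_adjoin`). Milne §2: for `E = End⁰(A)` a
product of fields, `E ⊗ k^{al} = ∏_σ k^{al}` and `C(A) ⊗ k^{al} = ∏_σ End(V_σ)`.
[cite: Milne1999LefschetzClasses, §2 pp. 645–650] -/
theorem exists_forall_pullbackOne_mem_adjoin_of_forall_comp_comm (hcomm : ∀ φ ψ : A ⟶ A, φ ≫ ψ = ψ ≫ φ) :
    ∃ φ : A ⟶ A, ∀ ψ : A ⟶ A, pullbackOne A ψ ∈ Algebra.adjoin ℂ {pullbackOne A φ} := by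
  haveI : FiniteDimensional ℂ (complexBetti A.X 1) := finite_complexBetti_abelianVariety A 1
  -- the additive family `ψ ↦ ψ^*`
  let F : (A ⟶ A) →+ Module.End ℂ (complexBetti A.X 1) :=
    { toFun := fun ψ => pullbackOne A ψ
      map_zero' := by
        change (complexBetti.map (0 : A ⟶ A).hom.hom.hom 1).hom = 0
        rw [complexBetti_map_zero_one]
        rfl
      map_add' := fun f g => by
        change (complexBetti.map (f + g).hom.hom.hom 1).hom = _
        rw [complexBetti_map_add_one]
        rfl }
  have hF : ∀ ψ, F ψ = pullbackOne A ψ := fun _ => rfl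
  have hc : ∀ φ ψ : A ⟶ A, Commute (F φ) (F ψ) := fun φ ψ => by
    change pullbackOne A φ * pullbackOne A ψ = pullbackOne A ψ * pullbackOne A φ
    rw [← pullbackOne_comp, ← pullbackOne_comp, hcomm]
  obtain ⟨φ, hφ⟩ := exists_forall_mem_adjoin_of_commute F hc
    fun ψ => isSemisimple_pullbackOne_of_forall_comp_comm hcomm ψ
  exact ⟨φ, fun ψ => hF ψ ▸ hF φ ▸ hφ ψ⟩

end Semisimple

/-! ### §3 Theorem 3.2 / Corollary 4.5 / Proposition 4.8 for commutative `End(A)` -/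

section Main

variable {A : AbelianVariety ℂ}

/-- **The conclusion of the record `Milne1999_specialLefschetzGroup_invariants_le` (Milne 1999, Cor. 4.5
with Thm. 4.4 and Thm. 3.2) PROVED for every complex abelian variety with commutative endomorphism ring**
(`A` isogenous to a product of pairwise non-isogenous simple abelian varieties of type I or of type IV
with `d = 1`, Milne §2): every class `x ∈ H^{2p}(A(ℂ); ℂ)` fixed by every element of
`specialLefschetzGroup (dim A) A.X` lies in `Dᵖ_hom(A)_ℂ = divisorClassesSpan A.X (dim A) p` — the
generator `φ` of `exists_forall_pullbackOne_mem_adjoin_of_forall_comp_comm`, diagonalisable by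
`iSup_eigenspace_pullbackOne_eq_top_of_forall_comp_comm`, fed to
`specialLefschetzGroup_invariants_le_of_forall_mem_adjoin`.
[cite: Milne1999LefschetzClasses, §2 pp. 645–650, Thm. 3.2, Prop. 3.6 (a), (c), p. 656, Cor. 4.5 (p. 659)]
[cite: MumfordAV1970, §19 Cor. 2 of Thm. 1 and p. 201] -/
theorem specialLefschetzGroup_invariants_le_of_forall_comp_comm (hcomm : ∀ φ ψ : A ⟶ A, φ ≫ ψ = ψ ≫ φ)
    (p : ℕ) (x : complexBetti A.X (2 * p)) (hx : ∀ g ∈ specialLefschetzGroup A.dim A.X, g (2 * p) x = x) :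
    x ∈ divisorClassesSpan A.X A.dim p := by
  obtain ⟨φ, hgen⟩ := exists_forall_pullbackOne_mem_adjoin_of_forall_comp_comm hcomm
  exact specialLefschetzGroup_invariants_le_of_forall_mem_adjoin φ hgen
    (iSup_eigenspace_pullbackOne_eq_top_of_forall_comp_comm hcomm φ) p x hx

/-- **Cor. 4.5 as an equality of sets, for commutative `End(A)`**: the `S(A)`-invariants of
`H^{2p}(A(ℂ); ℂ)` are EXACTLY `Dᵖ_hom(A)_ℂ`. [cite: Milne1999LefschetzClasses, Cor. 4.5 (p. 659)] -/
theorem setOf_forall_apply_eq_self_eq_divisorClassesSpan_of_forall_comp_comm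
    (hcomm : ∀ φ ψ : A ⟶ A, φ ≫ ψ = ψ ≫ φ) (p : ℕ) :
    {x : complexBetti A.X (2 * p) | ∀ g ∈ specialLefschetzGroup A.dim A.X, g (2 * p) x = x} =
      (divisorClassesSpan A.X A.dim p : Set _) :=
  Set.Subset.antisymm (fun x hx => specialLefschetzGroup_invariants_le_of_forall_comp_comm hcomm p x hx)
    fun _ hx _ hg => apply_eq_self_of_mem_specialLefschetzGroup hg hx

/-- **Milne Prop. 4.8, (c) ⇒ (a) on `A` itself, for commutative `End(A)`**: if `Hg′(A) = S(A)` then every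
rational `(p,p)`-class of `A` lies in `Dᵖ ⊗ ℂ` — `IsDivisorGenerated A`.
[cite: Milne1999LefschetzClasses, Prop. 4.8 and Cor. 4.5 (pp. 659–660)] -/
theorem isDivisorGenerated_of_hodgeGroup_eq_specialLefschetzGroup_of_forall_comp_comm
    (hcomm : ∀ φ ψ : A ⟶ A, φ ≫ ψ = ψ ≫ φ)
    (hHg : hodgeGroup A.dim A.X = specialLefschetzGroup A.dim A.X) : IsDivisorGenerated A :=
  fun p c hc hpp => specialLefschetzGroup_invariants_le_of_forall_comp_comm hcomm p c
    fun _ hg => apply_eq_self_of_mem_hodgeGroup (hHg ▸ hg) hc hpp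

/-- **The `S(A)(ℂ)`-invariant form for a given polarization class, commutative `End(A)`**: for `h`
rational with a Kähler multiple `s · h` (`s > 0`), every class of `H^{2p}(A(ℂ); ℂ)` fixed by `⋀^{2p}u` for
all `u ∈ S(A)(ℂ) = unitaryCentralizerGroup A h` lies in `Dᵖ(A) ⊗ ℂ`.
[cite: Milne1999LefschetzClasses, §1 p. 644, Thm. 3.2, Prop. 3.6 (a), (c), p. 656] -/
theorem mem_divisorClassesSpan_of_forall_exteriorPullback_eq_of_forall_comp_comm
    (hcomm : ∀ φ ψ : A ⟶ A, φ ≫ ψ = ψ ≫ φ)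
    {h : complexBetti A.X 2} (hQ : IsRationalClass h)
    (hK : ∃ s : ℝ, 0 < s ∧ IsKaehlerClass A.dim A.X ((s : ℂ) • h))
    (p : ℕ) (x : complexBetti A.X (2 * p))
    (hx : ∀ u ∈ unitaryCentralizerGroup A h,
      exteriorPullback (AbelianVariety.hasExteriorCohomologyH1_complexPoints A)
        (u : complexBetti A.X 1 →ₗ[ℂ] complexBetti A.X 1) (2 * p) x = x) :
    x ∈ divisorClassesSpan A.X A.dim p := by
  obtain ⟨φ, hgen⟩ := exists_forall_pullbackOne_mem_adjoin_of_forall_comp_comm hcomm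
  exact mem_divisorClassesSpan_of_forall_exteriorPullback_eq_of_generator φ
    (centralizerAlgebra_eq_centralizer_singleton_of_forall_mem_adjoin φ hgen)
    (iSup_eigenspace_pullbackOne_eq_top_of_forall_comp_comm hcomm φ) hQ hK p x hx

/-- **Commutative `End⁰(A)` (the `ℚ`-algebra form of the hypothesis)**: Cor. 4.5 / Thm. 3.2.
[cite: Milne1999LefschetzClasses, §2 pp. 645–650, Thm. 3.2, Cor. 4.5 (p. 659)] -/
theorem specialLefschetzGroup_invariants_le_of_endAlgebra_comm (hE : ∀ x y : A.endAlgebra, x * y = y * x)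
    (p : ℕ) (x : complexBetti A.X (2 * p)) (hx : ∀ g ∈ specialLefschetzGroup A.dim A.X, g (2 * p) x = x) :
    x ∈ divisorClassesSpan A.X A.dim p :=
  specialLefschetzGroup_invariants_le_of_forall_comp_comm (forall_comp_comm_iff_endAlgebra_comm.2 hE) p x hx

/-- **`End⁰(A)` a field** (e.g. `A` simple of type I, `End⁰(A) = F` totally real, or of type IV with
`d = 1`, `End⁰(A) = K` a CM field; Milne §2): Cor. 4.5 / Thm. 3.2.
[cite: Milne1999LefschetzClasses, §2 pp. 647–650 (types I, IV), Thm. 3.2, Cor. 4.5 (p. 659)] -/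
theorem specialLefschetzGroup_invariants_le_of_isField_endAlgebra (hF : IsField A.endAlgebra)
    (p : ℕ) (x : complexBetti A.X (2 * p)) (hx : ∀ g ∈ specialLefschetzGroup A.dim A.X, g (2 * p) x = x) :
    x ∈ divisorClassesSpan A.X A.dim p :=
  specialLefschetzGroup_invariants_le_of_endAlgebra_comm hF.mul_comm p x hx

/-- **Prop. 4.8 (c) ⇒ (a) for `End⁰(A)` commutative.** [cite: Milne1999LefschetzClasses, Prop. 4.8 and Cor. 4.5 (pp. 659–660)] -/
theorem isDivisorGenerated_of_hodgeGroup_eq_specialLefschetzGroup_of_endAlgebra_comm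
    (hE : ∀ x y : A.endAlgebra, x * y = y * x)
    (hHg : hodgeGroup A.dim A.X = specialLefschetzGroup A.dim A.X) : IsDivisorGenerated A :=
  isDivisorGenerated_of_hodgeGroup_eq_specialLefschetzGroup_of_forall_comp_comm
    (forall_comp_comm_iff_endAlgebra_comm.2 hE) hHg

end Main

end Literature.AlgebraicGeometry.Milne1999

end
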